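import Summits.HodgeConjecture.HodgeConjecture.Theorems.H413E2SWSplitPlaceLettersRiders
import Summits.HodgeConjecture.HodgeConjecture.Theorems.H413E2SWSplitPlaceFrameTorus
import HarnessLib

/-!
# H413 · E-2 · SW2 (iii) — the split-place LETTERS (selector form) with the formula of `β_v` exported (for the `hLD` torus riders)

Cell `hodgecm-mathlib`, crux H413 (`stmt-HodgeConjecture-24833`), child line `Cruxes/H413/Lines/F0_E2SiegelWeilWeilRange.lean`,
`StubSW2` (iii); sibling of ★ `Theorems/H413E2SWSplitPlaceLettersRiders` (p811547) and ★ `…SplitPlaceFrameTorus`.  PROOF lane,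
`--supports stmt-HodgeConjecture-24833 --as helper`.  HC_CM is proved only modulo the 7 printed citations until rung 0 closes.

`exists_splitPlaceSelector₃` = ★ `exists_splitPlaceSelector₂` (frame `fr = (β_v × id) ∘ placeSplitting⁻¹`, Haar clause, `hfib` core, selector
`sel` with `hfix`, `hTe`, riders `hrat`, `hint`) for a `β_v` GIVEN BY ITS FORMULA `β_v y = (y¹ + s 𝕋_v⁻¹ y², 𝕋_v y¹ − s y²)` (FIRST clause) —
so that the (S-1) consumer (`Theorems/H413E2SWDilateBoundCM :: hbd_CM`, letter `hLD`) reads the Levi torus twist through the SAME frame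
(★ `fr_vecMul_torus`, ★ `twistLM_torus_apply`, binders `(β) (hβ) (fr) (hfr)`).  Weil (1965) n° 50 p. 74.
[cite: Weil1965, Chap. V n° 50, pp. 73–74]
-/

set_option autoImplicit false
-- the cell's `Summit.HodgeConjecture.HodgeConjecture.…` namespace repeats the summit name by design (D-0017 layout)
set_option linter.dupNamespace false

noncomputable section

namespace Summit.HodgeConjecture.HodgeConjecture.Cruxes.H413.E2SWSplitPlaceLetters

open scoped Matrix NNReal ENNReal
open _root_.MeasureTheory NumberField IsDedekindDomain
open Literature.NumberTheory.Weil1964 Literature.NumberTheory.Weil1965 Literature.NumberTheory.Weil1965.UnitaryDoubling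
open Literature.NumberTheory.Automorphic Literature.NumberTheory.Automorphic.UnitaryGroup
open Literature.NumberTheory.GelbartRogawski1991 Literature.NumberTheory.GelbartRogawski1991.UnitaryDualPair
open Literature.NumberTheory.Automorphic.AdelicVector (evalAt trivialAt placeSplitting)
open Summit.HodgeConjecture.HodgeConjecture.Cruxes.H413.E2SWSplitPlaceFrame

variable (F E : Type) [Field F] [NumberField F] [Field E] [NumberField E] [Algebra F E] [Algebra.IsQuadraticExtension F E]
  (c : E ≃ₐ[F] E) {δ : E} (hcδ : c δ = -δ) (hδ : δ ≠ 0) {d : F} (hd : δ * δ = algebraMap F E d)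
  (N : ℕ) {n : ℕ} (e : Fin N × Fin 1 ≃ Fin n)
  (TV : Matrix (Fin N) (Fin N) F) (hV : TV.IsSymm) (hVd : IsUnit TV.det)
  (TW : Matrix (Fin 1) (Fin 1) F) (hW : TW.IsSymm) (hWd : IsUnit TW.det)
  (v : HeightOneSpectrum (𝓞 F))

/-- a linear equivalence from `K^m` onto a product of two such is continuous in the inverse direction. [folklore] -/
private theorem continuous_symm_prod' {K : Type} [Field K] [TopologicalSpace K] [IsTopologicalRing K] {m p q : ℕ}
    (β : (Fin m → K) ≃ₗ[K] ((Fin p → K) × (Fin q → K))) : Continuous β.symm := by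
  haveI : ContinuousSMul K K := ⟨continuous_mul⟩
  have h1 : Continuous fun a : Fin p → K => β.symm.toLinearMap (LinearMap.inl K _ _ a) :=
    (β.symm.toLinearMap.comp (LinearMap.inl K _ _)).continuous_on_pi
  have h2 : Continuous fun b : Fin q → K => β.symm.toLinearMap (LinearMap.inr K _ _ b) :=
    (β.symm.toLinearMap.comp (LinearMap.inr K _ _)).continuous_on_pi
  have heq : (fun z : (Fin p → K) × (Fin q → K) => β.symm z) =
      fun z => β.symm.toLinearMap (LinearMap.inl K _ _ z.1) + β.symm.toLinearMap (LinearMap.inr K _ _ z.2) := by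
    funext z
    rw [← map_add, LinearMap.inl_apply, LinearMap.inr_apply, Prod.mk_add_mk, add_zero, zero_add]
    rfl
  have hc : Continuous fun z : (Fin p → K) × (Fin q → K) => β.symm z := by
    rw [heq]
    exact (h1.comp continuous_fst).add (h2.comp continuous_snd)
  exact hc

include hδ in
/-- **THE SPLIT-PLACE LETTERS IN SELECTOR FORM, WITH THE FORMULA OF `β_v` AND THE RIDERS `hrat`, `hint`.** [cite: Weil1965, Chap. V n° 50, pp. 73–74] -/
theorem exists_splitPlaceSelector₃ {s : v.adicCompletion F} (hs : s * s = algebraMap F (v.adicCompletion F) d)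
    [MeasurableSpace (v.adicCompletion F)] [BorelSpace (v.adicCompletion F)]
    (μ : Measure (v.adicCompletion F)) [μ.IsAddHaarMeasure] :
    ∃ (β : (Fin (n + n) → v.adicCompletion F) ≃ₗ[v.adicCompletion F] ((Fin n → v.adicCompletion F) × (Fin n → v.adicCompletion F)))
      (fr : (Fin (n + n) → AdeleRing (𝓞 F) F) ≃ₜ
        ((Fin n → v.adicCompletion F) × (Fin n → v.adicCompletion F)) × trivialAt F (Fin (n + n)) v)
      (sel : GL (Fin n) (v.adicCompletion F) → UnitaryGroup.adelic F E c N (TV.map (algebraMap F E))),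
      (∀ y, β y =
        ((fun i => y (Fin.castAdd n i)) +
            s • ((UnitaryDualPair.gram F e TV TW).map (algebraMap F (v.adicCompletion F)))⁻¹ *ᵥ (fun i => y (Fin.natAdd n i)),
          (UnitaryDualPair.gram F e TV TW).map (algebraMap F (v.adicCompletion F)) *ᵥ (fun i => y (Fin.castAdd n i)) -
            s • (fun i => y (Fin.natAdd n i)))) ∧
      (∀ x, fr x = (β (evalAt F (Fin (n + n)) v x), ((placeSplitting F (Fin (n + n)) v).symm x).2)) ∧
      (∃ cst : ℝ≥0, 0 < cst ∧
        Measure.map β (Measure.pi fun _ : Fin (n + n) => μ) =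
          (cst : ℝ≥0∞) • ((Measure.pi fun _ : Fin n => μ).prod (Measure.pi fun _ : Fin n => μ))) ∧
      (∀ (x : Fin (n + n) → AdeleRing (𝓞 F) F) (b : F),
        hNorm F E c hcδ hδ N e TV hVd TW hWd x = algebraMap F (AdeleRing (𝓞 F) F) b →
          (fr x).1.1 ⬝ᵥ (fr x).1.2 = (b : v.adicCompletion F)) ∧
      (∀ g, ∀ y ∈ trivialAt F (Fin (n + n)) v, vDiagAct F E c hcδ hδ hd N e TV hV hVd TW hW hWd (sel g) y = y) ∧
      (∀ g x, fr (vDiagAct F E c hcδ hδ hd N e TV hV hVd TW hW hWd (sel g) x) =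
        ((((g : Matrix (Fin n) (Fin n) (v.adicCompletion F)) *ᵥ (fr x).1.1,
            ((g⁻¹ : GL (Fin n) (v.adicCompletion F)) : Matrix (Fin n) (Fin n) (v.adicCompletion F))ᵀ *ᵥ (fr x).1.2) :
              (Fin n → v.adicCompletion F) × (Fin n → v.adicCompletion F)), (fr x).2)) ∧
      (∀ ξ : Fin (n + n) → F, ξ ≠ 0 →
        (fr (ratPt F (Fin (n + n)) ξ)).1.1 ≠ 0 ∧ (fr (ratPt F (Fin (n + n)) ξ)).1.2 ≠ 0) ∧
      (∀ hU : UnitaryGroup.adelic F E c N (TV.map (algebraMap F E)), ∃ g : GL (Fin n) (v.adicCompletion F),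
        ∀ x : Fin (n + n) → AdeleRing (𝓞 F) F,
          (fr (vDiagAct F E c hcδ hδ hd N e TV hV hVd TW hW hWd hU x)).1 =
            ((g : Matrix (Fin n) (Fin n) (v.adicCompletion F)) *ᵥ (fr x).1.1,
              ((g⁻¹ : GL (Fin n) (v.adicCompletion F)) : Matrix (Fin n) (Fin n) (v.adicCompletion F))ᵀ *ᵥ (fr x).1.2)) := by
  obtain ⟨β, hβ, hQ, hHaar, hreal, hrat, hint⟩ := exists_splitPlaceFrame₃ F E c hcδ hδ hd N e TV hV hVd TW hW hWd v hs μ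
  choose sel hfix hii hsnd using hreal
  haveI : ContinuousSMul (v.adicCompletion F) (v.adicCompletion F) := ⟨continuous_mul⟩
  let βH : (Fin (n + n) → v.adicCompletion F) ≃ₜ ((Fin n → v.adicCompletion F) × (Fin n → v.adicCompletion F)) :=
    { toEquiv := β.toEquiv
      continuous_toFun := β.toLinearMap.continuous_on_pi
      continuous_invFun := continuous_symm_prod' β }
  let fr : (Fin (n + n) → AdeleRing (𝓞 F) F) ≃ₜ
      ((Fin n → v.adicCompletion F) × (Fin n → v.adicCompletion F)) × trivialAt F (Fin (n + n)) v :=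
    (placeSplitting F (Fin (n + n)) v).symm.toHomeomorph.trans (βH.prodCongr (Homeomorph.refl _))
  have hfr : ∀ x, fr x = (β (evalAt F (Fin (n + n)) v x), ((placeSplitting F (Fin (n + n)) v).symm x).2) := fun x => rfl
  refine ⟨β, fr, sel, hβ, hfr, hHaar, fun x b hxb => ?_, hfix, fun g x => ?_, fun ξ hξ => ?_, fun hU => ?_⟩
  · rw [hfr]
    change (β (evalAt F (Fin (n + n)) v x)).1 ⬝ᵥ (β (evalAt F (Fin (n + n)) v x)).2 = _
    rw [← hQ x, hxb]
    rfl
  · rw [hfr, hfr, hii g x, hsnd g x]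
  · rw [hfr]
    exact hrat ξ hξ
  · obtain ⟨g, hg⟩ := hint hU
    exact ⟨g, fun x => by rw [hfr, hfr, hg x]⟩

end Summit.HodgeConjecture.HodgeConjecture.Cruxes.H413.E2SWSplitPlaceLetters
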